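import Literature.NumberTheory.EllipticCurves.Rubin1991.TwoVariableMainConjecture
import HarnessLib

/-!
# Crux `CycTangentCM.CycTangentBound` (stmt-BirchSwinnertonDyer-22628), negative road: PERIOD RESCALING of the
# two-variable Katz–de Shalit frame — the frame predicate depends on the period pair `(Ω, Ω_p)` only through
# the combination `Ω_p / ι⁻¹(Ω)` (`--supports 22628`; nothing is closed; BSD is not proved by any of this)

Seat `prover-bsd-line-ctcm-p5` (D-0145 line `route-BirchSwinnertonDyer-CycTangentCM`, line `tangent-cone-parity`).
The lead's numerical refutation of the crux (cell STATUS 2026-08-28T00:41:46Z, `Cruxes/CycTangentBound/REFUTED.md`)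
reads the VALUES of a frame `G` (`IsKatzMeasure₂ ι v v̄ S κ₁ κ₂ γ₁ γ₂ ψ⁻¹ Ω δ Ω_p G`) on the split-prime line
in the normalisation `Ω = λ` (Néron lattice generator) with `Ω_p` a `p`-adic unit, whereas the crux — and the
existence fact `DeShalit1987.thmII417_exists_katzSheet` — quantify over an ARBITRARY complex period `Ω ≠ 0`.
This file records the elementary bookkeeping that reconciles the two: de Shalit's interpolation value (50)
at a character of type `(−m, j)` is homogeneous of degree `−(m+j)` in `Ω`
(`interpolationValue_mul_period`), and the `p`-adic side carries `Ω_p^{m+j}`, so the prescribed values are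
INVARIANT under `(Ω, Ω_p) ↦ (Ω·x, Ω_p·ι⁻¹(x))`, `x ∈ ℂˣ` (`IsKatzMeasure₂.rescale`,
`DeShalit1987.IsKatzBranch.rescale`); hence every frame is a frame for ANY prescribed complex period `Ω₀ ≠ 0`
with the `p`-adic period `Ω_p · ι⁻¹(Ω₀/Ω)` (`IsKatzMeasure₂.of_period`).  Consequence for the negative road: the
only frame-dependent unknown in the values `ι⁻¹(interpolationValue …)·Ω_p^{m}` at the typed points is the single
`p`-adic number `C = Ω_p · ι⁻¹(λ/Ω)`, entering a value of weight `m` as `C^m`.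

Theorems only; no `def`, no named fact, no `sorry`.
References: [deShalit1987] II.4.12 Remarks (iii)–(iv) (p. 66–67), II.4.14 (36) (p. 71), II.4.16 (50) (p. 77).
-/

set_option autoImplicit false

noncomputable section

open scoped Classical NumberField
open NumberField IsDedekindDomain Field
open Literature.NumberTheory.EllipticCurves Literature.NumberTheory.GaloisRepresentations

namespace Literature.NumberTheory.EllipticCurves

universe u

variable {K : Type u} [Field K] [NumberField K] {p : ℕ}

/-! ### §1 Homogeneity of the interpolation value in the complex period -/

/-- **de Shalit's interpolation value (50) is homogeneous of degree `−(m+j)` in `Ω`**: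
`interpolationValue … (Ω·x) … = (x^{m+j})⁻¹ · interpolationValue … Ω …`.
[cite: deShalit1987, II.4.16 (50) (p. 77)] -/
theorem DeShalit1987.interpolationValue_mul_period (v vbar : HeightOneSpectrum (𝓞 K))
    (S : Finset (HeightOneSpectrum (𝓞 K))) (ε : HeckeCharacter K) (m j : ℕ) (Ω x δ Lval : ℂ) :
    DeShalit1987.interpolationValue p v vbar S ε m j (Ω * x) δ Lval =
      (x ^ (m + j))⁻¹ * DeShalit1987.interpolationValue p v vbar S ε m j Ω δ Lval := by
  unfold DeShalit1987.interpolationValue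
  rw [mul_pow, mul_inv]
  ring

variable [Fact p.Prime]

/-- **The `p`-adic value is invariant under `(Ω, Ω_p) ↦ (Ω·x, Ω_p·ι⁻¹(x))`, `x ≠ 0`**:
`ι⁻¹(interpolationValue … (Ω·x) …) · (Ω_p·ι⁻¹x)^{m+j} = ι⁻¹(interpolationValue … Ω …) · Ω_p^{m+j}`.
[cite: deShalit1987, II.4.14 (36) (p. 71) and II.4.16 (50) (p. 77)] -/
theorem DeShalit1987.padicValue_rescale (ι : PadicAlgCl p ≃+* ℂ) (v vbar : HeightOneSpectrum (𝓞 K))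
    (S : Finset (HeightOneSpectrum (𝓞 K))) (ε : HeckeCharacter K) (m j : ℕ) (Ω δ Lval : ℂ) {x : ℂ}
    (hx : x ≠ 0) (Ωp : ℂ_[p]) :
    (((ι.symm (DeShalit1987.interpolationValue p v vbar S ε m j (Ω * x) δ Lval)) : PadicAlgCl p) : ℂ_[p]) *
        (Ωp * ((ι.symm x : PadicAlgCl p) : ℂ_[p])) ^ (m + j) =
      (((ι.symm (DeShalit1987.interpolationValue p v vbar S ε m j Ω δ Lval)) : PadicAlgCl p) : ℂ_[p]) *
        Ωp ^ (m + j) := by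
  have hx' : (((ι.symm x : PadicAlgCl p)) : ℂ_[p]) ≠ 0 := by
    rw [PadicComplex.coe_eq, map_ne_zero_iff _ (algebraMap (PadicAlgCl p) ℂ_[p]).injective,
      map_ne_zero_iff _ ι.symm.injective]
    exact hx
  rw [DeShalit1987.interpolationValue_mul_period, map_mul, map_inv₀, map_pow, PadicComplex.coe_eq,
    PadicComplex.coe_eq, PadicComplex.coe_eq, map_mul, map_inv₀, map_pow, mul_pow]
  rw [PadicComplex.coe_eq] at hx'
  field_simp

/-! ### §2 Rescaling the frames -/

/-- **The one-variable Katz branch predicate is invariant under `(Ω, Ω_p) ↦ (Ω·x, Ω_p·ι⁻¹(x))`** (`x ≠ 0`).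
[cite: deShalit1987, II.4.12 Remark (iv) (p. 67) and II.4.16 (50) (p. 77)] -/
theorem DeShalit1987.IsKatzBranch.rescale {ι : PadicAlgCl p ≃+* ℂ} {v vbar : HeightOneSpectrum (𝓞 K)}
    {S : Finset (HeightOneSpectrum (𝓞 K))} {κ : ZpExtension K p} {γ : absoluteGaloisGroup K}
    {lam : HeckeCharacter K} {Ω δ : ℂ} {Ωp : ℂ_[p]} {G : PowerSeries (PadicComplexInt p)}
    (hG : DeShalit1987.IsKatzBranch ι v vbar S κ γ lam Ω δ Ωp G) {x : ℂ} (hx : x ≠ 0) :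
    DeShalit1987.IsKatzBranch ι v vbar S κ γ lam (Ω * x) δ (Ωp * ((ι.symm x : PadicAlgCl p) : ℂ_[p])) G := by
  intro ρ r m j hr hκ hjm hinf hunr hL
  rw [DeShalit1987.padicValue_rescale ι v vbar S _ m j Ω δ _ hx Ωp]
  exact hG ρ r m j hr hκ hjm hinf hunr hL

/-- **The two-variable frame predicate is invariant under `(Ω, Ω_p) ↦ (Ω·x, Ω_p·ι⁻¹(x))`** (`x ≠ 0`): the
prescribed value at every typed point is unchanged (`padicValue_rescale`).
[cite: deShalit1987, II.4.12 Remark (iv) (p. 67), II.4.17 (54) (p. 78)] -/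
theorem IsKatzMeasure₂.rescale {ι : PadicAlgCl p ≃+* ℂ} {v vbar : HeightOneSpectrum (𝓞 K)}
    {S : Finset (HeightOneSpectrum (𝓞 K))} {κ₁ κ₂ : ZpExtension K p} {γ₁ γ₂ : absoluteGaloisGroup K}
    {lam : HeckeCharacter K} {Ω δ : ℂ} {Ωp : ℂ_[p]} {G : PowerSeries (PowerSeries (PadicComplexInt p))}
    (hG : IsKatzMeasure₂ ι v vbar S κ₁ κ₂ γ₁ γ₂ lam Ω δ Ωp G) {x : ℂ} (hx : x ≠ 0) :
    IsKatzMeasure₂ ι v vbar S κ₁ κ₂ γ₁ γ₂ lam (Ω * x) δ (Ωp * ((ι.symm x : PadicAlgCl p) : ℂ_[p])) G := by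
  intro ρ r m j hr hκ hjm hinf hunr hL
  rw [DeShalit1987.padicValue_rescale ι v vbar S _ m j Ω δ _ hx Ωp]
  exact hG ρ r m j hr hκ hjm hinf hunr hL

/-- **Every frame is a frame for ANY prescribed complex period `Ω₀ ≠ 0`**, with the `p`-adic period
`Ω_p · ι⁻¹(Ω₀/Ω)` (which is `≠ 0` when `Ω_p ≠ 0`): in particular a consumer may read a frame of the crux in
the normalisation `Ω = λ` (Néron lattice generator) at the cost of replacing `Ω_p` by the single unknown
`C = Ω_p · ι⁻¹(λ/Ω)`. [cite: deShalit1987, II.4.12 Remarks (iii)–(iv) (p. 66–67)] -/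
theorem IsKatzMeasure₂.of_period {ι : PadicAlgCl p ≃+* ℂ} {v vbar : HeightOneSpectrum (𝓞 K)}
    {S : Finset (HeightOneSpectrum (𝓞 K))} {κ₁ κ₂ : ZpExtension K p} {γ₁ γ₂ : absoluteGaloisGroup K}
    {lam : HeckeCharacter K} {Ω δ : ℂ} {Ωp : ℂ_[p]} {G : PowerSeries (PowerSeries (PadicComplexInt p))}
    (hG : IsKatzMeasure₂ ι v vbar S κ₁ κ₂ γ₁ γ₂ lam Ω δ Ωp G) (hΩ : Ω ≠ 0) {Ω₀ : ℂ} (hΩ₀ : Ω₀ ≠ 0) :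
    IsKatzMeasure₂ ι v vbar S κ₁ κ₂ γ₁ γ₂ lam Ω₀ δ (Ωp * ((ι.symm (Ω₀ / Ω) : PadicAlgCl p) : ℂ_[p])) G := by
  have h := hG.rescale (x := Ω₀ / Ω) (div_ne_zero hΩ₀ hΩ)
  rwa [mul_div_cancel₀ Ω₀ hΩ] at h

/-- The rescaled `p`-adic period `Ω_p · ι⁻¹(Ω₀/Ω)` of `IsKatzMeasure₂.of_period` is non-zero (for `Ω, Ω₀, Ω_p`
non-zero) — the non-vanishing clause of the period pair in the rescaled normalisation (arithmetic bookkeeping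
for de Shalit's Remark (iv): the pair is determined up to this rescaling). [cite: deShalit1987, II.4.12 Remarks (iii)–(iv) (p. 66–67)] -/
theorem IsKatzMeasure₂.rescaled_period_ne_zero (ι : PadicAlgCl p ≃+* ℂ) {Ω Ω₀ : ℂ} {Ωp : ℂ_[p]}
    (hΩ : Ω ≠ 0) (hΩ₀ : Ω₀ ≠ 0) (hΩp : Ωp ≠ 0) :
    Ωp * ((ι.symm (Ω₀ / Ω) : PadicAlgCl p) : ℂ_[p]) ≠ 0 := by
  refine mul_ne_zero hΩp ?_
  rw [PadicComplex.coe_eq, map_ne_zero_iff _ (algebraMap (PadicAlgCl p) ℂ_[p]).injective,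
    map_ne_zero_iff _ ι.symm.injective]
  exact div_ne_zero hΩ₀ hΩ

end Literature.NumberTheory.EllipticCurves

end
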